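import Mathlib
import Summits.KontsevichZagierPeriods.Zeta5Search.DenomLaw.ThresholdModelDeep
import Summits.KontsevichZagierPeriods.Zeta5Search.DenomLaw.ThresholdModelCount

/-!
# ζ(5) search — DENOM-LAW: the threshold model in ρ-coordinates, part 5: the dictionary `b ↦ (ρ, R₀)`, the representative side, and a concrete deep cell

Cell `pub-zeta5`, track DENOM-LAW (K1 typing order item (1), «ThresholdModel port»): denom-engine-d2 g11's kernel-checked scratch module
`denom-law/engine-d2/g11/lean/DeepCellLemmas.lean` (THRESHOLD-X3; theory-d1 g9/g10 SELECTION-LAW-PROOF Theorem S) filed VERBATIM in five parts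
(≤ 400 lines each; split plan THRESHOLD-X3 §2 (a); docstrings added where the scratch file had none) by denom-prover-d1 g5.  Part 5 of 5.
HONEST FRAMING: systematic search; MODEL/structure side — elementary integer inequalities of the level model; nothing about ζ(5); no γ; no irrationality claim; records in print UNMOVED.
The full mathematical header (setting, dictionary, what is proved) is the module docstring of part 1 (`ThresholdModelRho.lean`).
-/

namespace Summit.KontsevichZagierPeriods.Zeta5Search.DenomLaw.ThresholdModel.Rho

/-! ## Dictionary with the cell `b = (b₀; b₁ ≥ … ≥ b₇)`: the octave enters only through `q = (m−1)p` -/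

section Dictionary
variable (p q b0 : ℤ) (b : Fin 7 → ℤ)

/-- `ρ_j = b₀ − 2b_j − (m−1)p`, written with `q = (m−1)p`. -/
def rhoOf : Fin 7 → ℤ := fun j => b0 - 2 * b j - q
/-- `R₀ = b₀ − (3m−2)p = b₀ − 3q − p`. -/
def R0Of : ℤ := b0 - 3 * q - p
/-- `a = #{j : b_j ≥ mp}` (point digit `m`), `mp = q + p`. -/
def aCountB : ℤ := ∑ j : Fin 7, indic (q + p ≤ b j)
/-- `λ₁ = #{k > 1 : ⌊(b₀ − b₁ − b_k)/p⌋ = m − 1}` = `#{k > 1 : b₀ − b₁ − b_k ≤ q + p − 1}` (0-indexed here). -/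
def lamB0 : ℤ := indic (b0 - b 0 - b 1 ≤ q + p - 1) + indic (b0 - b 0 - b 2 ≤ q + p - 1) + indic (b0 - b 0 - b 3 ≤ q + p - 1) +
  indic (b0 - b 0 - b 4 ≤ q + p - 1) + indic (b0 - b 0 - b 5 ≤ q + p - 1) + indic (b0 - b 0 - b 6 ≤ q + p - 1)
/-- `λ₂`. -/
def lamB1 : ℤ := indic (b0 - b 1 - b 2 ≤ q + p - 1) + indic (b0 - b 1 - b 3 ≤ q + p - 1) + indic (b0 - b 1 - b 4 ≤ q + p - 1) +
  indic (b0 - b 1 - b 5 ≤ q + p - 1) + indic (b0 - b 1 - b 6 ≤ q + p - 1)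
/-- `λ₃`. -/
def lamB2 : ℤ := indic (b0 - b 2 - b 3 ≤ q + p - 1) + indic (b0 - b 2 - b 4 ≤ q + p - 1) + indic (b0 - b 2 - b 5 ≤ q + p - 1) +
  indic (b0 - b 2 - b 6 ≤ q + p - 1)
/-- `λ₄`. -/
def lamB3 : ℤ := indic (b0 - b 3 - b 4 ≤ q + p - 1) + indic (b0 - b 3 - b 5 ≤ q + p - 1) + indic (b0 - b 3 - b 6 ≤ q + p - 1)
/-- `λ₅`. -/
def lamB4 : ℤ := indic (b0 - b 4 - b 5 ≤ q + p - 1) + indic (b0 - b 4 - b 6 ≤ q + p - 1)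
/-- `λ₆`. -/
def lamB5 : ℤ := indic (b0 - b 5 - b 6 ≤ q + p - 1)

/-- engine-d2 g9's DEEP filter verbatim on the cell (`a ∈ {0,1,2}`, `λ ≤ DEEP[a]` componentwise). -/
def IsDeepCountB : Prop :=
  (aCountB p q b = 0 ∧ lamB0 p q b0 b ≤ 3 ∧ lamB1 p q b0 b ≤ 1 ∧ lamB2 p q b0 b = 0 ∧ lamB3 p q b0 b = 0 ∧ lamB4 p q b0 b = 0 ∧
      lamB5 p q b0 b = 0) ∨
  (aCountB p q b = 1 ∧ lamB0 p q b0 b ≤ 2 ∧ lamB1 p q b0 b ≤ 1 ∧ lamB2 p q b0 b = 0 ∧ lamB3 p q b0 b = 0 ∧ lamB4 p q b0 b = 0 ∧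
      lamB5 p q b0 b = 0) ∨
  (aCountB p q b = 2 ∧ lamB0 p q b0 b ≤ 2 ∧ lamB1 p q b0 b = 0 ∧ lamB2 p q b0 b = 0 ∧ lamB3 p q b0 b = 0 ∧ lamB4 p q b0 b = 0 ∧
      lamB5 p q b0 b = 0)

/-- a D cell of octave `m` at `p` in b-coordinates, `q = (m−1)p`: `b₁ ≥ … ≥ b₇`, point digits `⌊b_j/p⌋ ∈ {m−1, m}`
(`q ≤ b_j ≤ q + 2p − 1`), pair digits `⌊(b₀−b_j−b_k)/p⌋ ∈ {m−1, m}`, and the deep filter.  (The `fd = 2m` window and BZ's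
polytope extras are not needed and not recorded.) -/
structure BCell : Prop where
  odd_p : p % 2 = 1
  three_le_p : 3 ≤ p
  anti : Antitone b
  point : ∀ j, q ≤ b j ∧ b j ≤ q + 2 * p - 1
  pair : ∀ j k, j ≠ k → q ≤ b0 - b j - b k ∧ b0 - b j - b k ≤ q + 2 * p - 1
  deep : IsDeepCountB p q b0 b

end Dictionary

section DictionaryBridge
variable {p q b0 : ℤ} {b : Fin 7 → ℤ}

/-- Unfolding `rhoOf`. -/
theorem rhoOf_apply (j : Fin 7) : rhoOf q b0 b j = b0 - 2 * b j - q := rfl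

/-- `ρ` is ascending when `b` is descending. -/
theorem rhoOf_monotone (hb : Antitone b) : Monotone (rhoOf q b0 b) := by
  intro i j hij
  have := hb hij
  simp only [rhoOf_apply]
  linarith

/-- `a` computed from `b` is `a` computed from `(R₀, ρ)`. -/
theorem aCountB_eq : aCountB p q b = aCount p (R0Of p q b0) (rhoOf q b0 b) := by
  unfold aCountB aCount countLe
  apply Finset.sum_congr rfl
  intro j _
  simp only [rhoOf_apply, R0Of]
  exact indic_congr (by constructor <;> intro h <;> linarith)

/-- `pair digit (j,k) = m−1 ⟺ ρ_j + ρ_k < 2p`. -/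
theorem pairLow_iff (j k : Fin 7) : b0 - b j - b k ≤ q + p - 1 ↔ rhoOf q b0 b j + rhoOf q b0 b k < 2 * p := by
  simp only [rhoOf_apply]; constructor <;> intro h <;> linarith

/-- The `λ` vector computed from `b` is the one computed from `(R₀, ρ)`. -/
theorem lamB_eq :
    lamB0 p q b0 b = lam0 p (rhoOf q b0 b) ∧ lamB1 p q b0 b = lam1 p (rhoOf q b0 b) ∧ lamB2 p q b0 b = lam2 p (rhoOf q b0 b) ∧
    lamB3 p q b0 b = lam3 p (rhoOf q b0 b) ∧ lamB4 p q b0 b = lam4 p (rhoOf q b0 b) ∧ lamB5 p q b0 b = lam5 p (rhoOf q b0 b) := by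
  refine ⟨?_, ?_, ?_, ?_, ?_, ?_⟩ <;>
    simp only [lamB0, lamB1, lamB2, lamB3, lamB4, lamB5, lam0, lam1, lam2, lam3, lam4, lam5,
      indic_congr (pairLow_iff (p := p) (q := q) (b0 := b0) (b := b) _ _)]

/-- The counting form of DEEP in `b`-coordinates is the one in `(R₀, ρ)`-coordinates. -/
theorem isDeepCountB_iff : IsDeepCountB p q b0 b ↔ IsDeepCount p (R0Of p q b0) (rhoOf q b0 b) := by
  unfold IsDeepCountB IsDeepCount
  obtain ⟨e0, e1, e2, e3, e4, e5⟩ := lamB_eq (p := p) (q := q) (b0 := b0) (b := b)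
  rw [aCountB_eq, e0, e1, e2, e3, e4, e5]

/-- **a D cell in b-coordinates gives a `DeepCell` in ρ-coordinates** (so every theorem above applies to it). -/
theorem BCell.deepCell (h : BCell p q b0 b) : DeepCell p (R0Of p q b0) (rhoOf q b0 b) := by
  have hp := h.odd_p
  refine DeepCell.of_count h.odd_p h.three_le_p (rhoOf_monotone h.anti) ?_ ?_ ?_ ?_ ?_ (isDeepCountB_iff.1 h.deep)
  · intro j
    have := h.point j
    simp only [rhoOf_apply, R0Of]
    omega
  · intro j
    have := h.point j
    simp only [rhoOf_apply, R0Of]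
    omega
  · intro j
    have := h.point j
    simp only [rhoOf_apply, R0Of]
    omega
  · have := h.pair 0 1 (by decide)
    simp only [rhoOf_apply]
    omega
  · have := h.pair 5 6 (by decide)
    simp only [rhoOf_apply]
    omega

/-- e.g. the box of Theorem S for a cell given by `b`: `b₀ − 2b_j ≥ (m−1)p + 1` for every block and `0 ≤ b₀ − (3m−2)p < 3p`. -/
theorem BCell.box (h : BCell p q b0 b) : (∀ j, q + 1 ≤ b0 - 2 * b j) ∧ 0 ≤ b0 - 3 * q - p ∧ b0 - 3 * q - p < 3 * p := by
  obtain ⟨h1, h2, h3⟩ := h.deepCell.box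
  refine ⟨fun j => ?_, h2, h3⟩
  have := h1 j
  simp only [rhoOf_apply] at this
  omega

end DictionaryBridge

/-! ## Theorem S (ii)/(iii) in these coordinates and the mirror symmetry of dominance (S3c, S4a/b) -/

section RepSide
variable (p R0 : ℤ) (r : Fin 7 → ℤ)

/-- (ii) on the rep side `u > 0`: `R(u) ≤ L(u)`. -/
theorem R_le_L {u : ℤ} (hu : 0 < u) : R p r u ≤ L p r u := by
  unfold R L countLt
  exact Finset.sum_le_sum fun _ _ => indic_mono fun h => by linarith

/-- (ii) on the rep side `u > 0`: `n₋(u) ≤ n₊(u)`. -/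
theorem nm_le_np {u : ℤ} (hu : 0 < u) : nm p R0 u ≤ np p R0 u := by
  unfold nm np
  exact indic_mono fun h => by linarith

/-- (iii) `L` is non-decreasing in `u`. -/
theorem L_mono {u u' : ℤ} (h : u ≤ u') : L p r u ≤ L p r u' := by
  unfold L countLt
  exact Finset.sum_le_sum fun _ _ => indic_mono fun h' => by linarith

/-- (iii) `R` is non-increasing in `u`. -/
theorem R_anti {u u' : ℤ} (h : u ≤ u') : R p r u' ≤ R p r u := by
  unfold R countLt
  exact Finset.sum_le_sum fun _ _ => indic_mono fun h' => by linarith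

/-- (iii) `n₊` is non-decreasing in `u`. -/
theorem np_mono {u u' : ℤ} (h : u ≤ u') : np p R0 u ≤ np p R0 u' := by
  unfold np
  exact indic_mono fun h' => by linarith

/-- (iii) `n₋` is non-increasing in `u`. -/
theorem nm_anti {u u' : ℤ} (h : u ≤ u') : nm p R0 u' ≤ nm p R0 u := by
  unfold nm
  exact indic_mono fun h' => by linarith

/-- the mirror `u ↦ −u` of a class other than the centre class `u = p` is a class. -/
theorem isClass_neg {u : ℤ} (hc : IsClass p R0 u) (hp : u ≠ p) : IsClass p R0 (-u) := by
  obtain ⟨h1, h2, h3⟩ := hc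
  refine ⟨by omega, by omega, by omega⟩

/-- … and has the same score. -/
theorem score_neg {u : ℤ} (hc : IsClass p R0 u) (hp : u ≠ p) : score p R0 r (-u) = score p R0 r u := by
  obtain ⟨h1, _, _⟩ := hc
  have e : indic (-u = 0 ∨ -u = p) = indic (u = 0 ∨ u = p) := indic_congr (by omega)
  unfold score centre
  rw [delta_neg, e]

/-- **mirror symmetry of the dominant set (S3c)**: if `u ≠ p` is dominant then so is `−u`. -/
theorem isDominant_neg {u : ℤ} (hd : IsDominant p R0 r u) (hp : u ≠ p) : IsDominant p R0 r (-u) := by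
  obtain ⟨hc, hmin⟩ := hd
  refine ⟨isClass_neg p R0 hc hp, fun u' hu' => ?_⟩
  rw [score_neg p R0 r hc hp]
  exact hmin u' hu'

end RepSide

/-! ## Non-vacuity and tightness on a concrete deep cell -/

section Example

/-- the deep cell `b = (28; 10,9,9,8,7,7,7)` of octave `m = 1` at `p = 11`: `ρ = (8,10,10,12,14,14,14)`, `R₀ = 17`,
`a = 0`, `λ = (3,1)` (exhaustive block (1,11) of engine-d2 g10; dominant classes `u = ±1, ±3` of defect 4). -/
def exRho : Fin 7 → ℤ := ![8, 10, 10, 12, 14, 14, 14]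

/-- the same cell in b-coordinates (`q = (m−1)p = 0`). -/
def exB : Fin 7 → ℤ := ![10, 9, 9, 8, 7, 7, 7]

example : BCell 11 0 28 exB := by
  refine ⟨by decide, by decide, Fin.antitone_iff_succ_le.2 (by decide), by decide, by decide, ?_⟩
  unfold IsDeepCountB; decide

example : rhoOf 0 28 exB = exRho ∧ R0Of 11 0 28 = 17 := by
  constructor
  · funext j; fin_cases j <;> rfl
  · rfl

/-- the hypotheses of `DeepCell` are satisfiable (and by a real cell). -/
example : DeepCell 11 17 exRho :=
  DeepCell.of_count (by decide) (by decide) (Fin.monotone_iff_le_succ.2 (by decide)) (by decide) (by decide)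
    (by decide) (by decide) (by decide) (by unfold IsDeepCount; decide)

/-- tightness of `dominant_delta_le_four`: on this cell the class `u = 1` is non-central with defect 4 … -/
example : delta 11 17 exRho 1 = 4 ∧ centre 11 1 = 0 := by decide

/-- … and no class does better: every class `u ∈ (−11, 11]`, `u ≡ R₀ (mod 2)` has score `≥ 4`, so `u = 1` is dominant
with `δ = 4` and the bound `4` cannot be lowered. -/
example : ∀ u ∈ Finset.Ioc (-11 : ℤ) 11, (u - 17) % 2 = 0 → 4 ≤ score 11 17 exRho u := by decide

/-- THRESHOLD-X2 §4's non-deep control cell `b = (39; 19,19,10,10,9,9,9)`, `p = 11`, `m = 1`: `ρ = (1,1,19,19,21,21,21)`, `R₀ = 28`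
(`a = 2`, `λ = (3,2)`: inside every digit box, NOT deep). -/
def rimRho : Fin 7 → ℤ := ![1, 1, 19, 19, 21, 21, 21]

/-- the deep hypothesis of `one_move` cannot be dropped: this cell satisfies every other field of `DeepCell` (parity, point and
pair digits, sortedness), is not deep, and its adjacent classes `u = 8 → 10` exchange two roots each way (`up = down = 2`;
types `(2,2,0,1) → (4,0,0,1)`, both dominant — THRESHOLD-X2 §4). -/
example : (∀ j, (rimRho j - 28) % 2 = 1) ∧ (∀ j, 28 - 3 * 11 + 2 ≤ rimRho j ∧ rimRho j ≤ 28 + 11) ∧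
    0 ≤ rimRho 0 + rimRho 1 ∧ rimRho 5 + rimRho 6 ≤ 4 * 11 - 2 ∧ Monotone rimRho ∧
    ¬ IsDeepCount 11 28 rimRho ∧ up 11 28 rimRho 8 = 2 ∧ down 11 28 rimRho 8 = 2 := by
  refine ⟨by decide, by decide, by decide, by decide, Fin.monotone_iff_le_succ.2 (by decide), ?_, by decide, by decide⟩
  unfold IsDeepCount; decide

end Example

end Summit.KontsevichZagierPeriods.Zeta5Search.DenomLaw.ThresholdModel.Rho
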